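import Mathlib
import HarnessLib
import Literature.Geometry.DiscreteGeometry.KissingCertDefs
import Summits.AtomisticToContinuum.Crystallization.Theorems.PricedLinkCensusSoftFourRingsCapKernel
import Summits.AtomisticToContinuum.Crystallization.Theorems.PricedLinkCensusSoftFourRingsCapSums
import Summits.AtomisticToContinuum.Crystallization.Theorems.PricedLinkCensusSoftFourRingsCapDefs
import Summits.AtomisticToContinuum.Crystallization.Theorems.PricedLinkCensusSoftFourRingsCapCertComp

/-!
# Bond-to-cap certificate: semantics (evaluation lemmas) of the reflective constructions of `PricedLinkCensusSoftFourRingsCapCertComp`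

Route `PricedLinkCensus`, item `SoftFourRings` (stmt-AtomisticToContinuum-14234), crux `Cap.BondToCap`
(seat c3).  Part 1/5 of the semantics-and-soundness layer of the certificate checker
(`PricedLinkCensusSoftFourRingsCapCertComp`).  Master valid inequality, for a unit pole `p ∉ X` and
unit vectors `X` (`u_x = ⟪p,x⟫`, `t_xy = ⟪x,y⟫`): `Σ_{x,y∈X} Ocore(u_x,u_y,t_xy) + Σ_x Dcross(u_x) + c₀ ≥ 0`;
splitting at each `x` into the diagonal, four bonded and seven non-bonded terms and moving the free
polynomials with the degree identities gives `0 ≤ Σ D + Σ O_b + Σ O_n + c₀ ≤ 12α + 48β_b + 84β_n + c₀ < 0`.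
-/

namespace Summit.AtomisticToContinuum.Crystallization.Theorems.Cap.Cert

open Real RealInnerProductSpace Finset
open Literature.Geometry.DiscreteGeometry Literature.Geometry.DiscreteGeometry.PolyCert
  Literature.Geometry.DiscreteGeometry.PolyCert.SPoly

/-! ### Evaluation lemmas -/

/-- `eval Sp = t − uv`. [folklore] -/
@[simp] theorem eval_Sp (u v t : ℝ) : eval Sp u v t = t - u * v := by
  simp [Sp, Mono.eval]; ring

/-- `eval Ep = (1 − u²)(1 − v²)`. [folklore] -/
@[simp] theorem eval_Ep (u v t : ℝ) : eval Ep u v t = (1 - u ^ 2) * (1 - v ^ 2) := by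
  simp [Ep, Mono.eval]; ring

/-- `eval (capQPoly k) = capQ k (t − uv) ((1−u²)(1−v²))`. [folklore] -/
theorem eval_capQPoly (u v t : ℝ) :
    ∀ k, eval (capQPoly k) u v t = capQ k (t - u * v) ((1 - u ^ 2) * (1 - v ^ 2))
  | 0 => by simp [capQPoly]
  | 1 => by simp [capQPoly]
  | k + 2 => by
    rw [capQPoly, eval_normalize, eval_append, eval_mulN, eval_neg, eval_mulN, eval_smul, eval_Sp,
      eval_Ep, eval_capQPoly u v t (k + 1), eval_capQPoly u v t k, capQ_add_two]
    push_cast; ring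

/-- `eval (powU a) = u^a`. [folklore] -/
@[simp] theorem eval_powU (a : ℕ) (u v t : ℝ) : eval (powU a) u v t = u ^ a := by
  simp [powU, Mono.eval]

/-- `eval (powV a) = v^a`. [folklore] -/
@[simp] theorem eval_powV (a : ℕ) (u v t : ℝ) : eval (powV a) u v t = v ^ a := by
  simp [powV, Mono.eval]

/-- `eval (phiU w) = φ_w(u)`. [folklore] -/
@[simp] theorem eval_phiU (w : List ℤ) (u v t : ℝ) : eval (phiU w) u v t = phiW w u := by
  rw [phiU, eval_lsum, List.map_map, phiW, ← list_sum_map_range]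
  congr 1
  refine List.map_congr_left fun a _ => ?_
  simp

/-- `eval (phiV w) = φ_w(v)`. [folklore] -/
@[simp] theorem eval_phiV (w : List ℤ) (u v t : ℝ) : eval (phiV w) u v t = phiW w v := by
  rw [phiV, eval_lsum, List.map_map, phiW, ← list_sum_map_range]
  congr 1
  refine List.map_congr_left fun a _ => ?_
  simp

/-- Real value of the three-point part. [folklore] -/
noncomputable def F3val (bs : List TBlk) (u v t : ℝ) : ℝ :=
  (bs.map fun b => (b.ws.map fun w => phiW w u * phiW w v *
    capQ b.k (t - u * v) ((1 - u ^ 2) * (1 - v ^ 2))).sum).sum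

/-- `eval (F3Poly bs) = F3val bs`. [folklore] -/
theorem eval_F3Poly (bs : List TBlk) (u v t : ℝ) : eval (F3Poly bs) u v t = F3val bs u v t := by
  rw [F3Poly, eval_lsum, List.map_map, F3val]
  congr 1
  refine List.map_congr_left fun b _ => ?_
  simp only [Function.comp_apply, eval_lsum, List.map_map]
  congr 1
  refine List.map_congr_left fun w _ => ?_
  simp only [Function.comp_apply, eval_mulN, eval_phiU, eval_phiV, eval_capQPoly]

/-- `eval (legT l) = legendreI l t 1`. [folklore] -/
@[simp] theorem eval_legT (l : ℕ) (u v t : ℝ) : eval (legT l) u v t = legendreI l t 1 := by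
  rw [legT, eval_legendreIPoly]; simp

/-- `eval (legU l) = legendreI l u 1`. [folklore] -/
@[simp] theorem eval_legU (l : ℕ) (u v t : ℝ) : eval (legU l) u v t = legendreI l u 1 := by
  rw [legU, eval_legendreIPoly]; simp

/-- Real value of the pair part of the Legendre couplings. [folklore] -/
noncomputable def LcoupOval (bs : List LBlk) (u v t : ℝ) : ℝ :=
  (bs.map fun b => (b.vs.map fun w => phiW w.tail u * phiW w.tail v * legendreI b.l t 1).sum).sum

/-- Real value of the point (cross) part of the Legendre couplings. [folklore] -/
noncomputable def LcoupDval (bs : List LBlk) (u : ℝ) : ℝ :=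
  (bs.map fun b => (b.vs.map fun w => 2 * (w.headD 0 : ℝ) * (phiW w.tail u * legendreI b.l u 1)).sum).sum

/-- `eval (LcoupOPoly bs) = LcoupOval bs`. [folklore] -/
theorem eval_LcoupOPoly (bs : List LBlk) (u v t : ℝ) :
    eval (LcoupOPoly bs) u v t = LcoupOval bs u v t := by
  rw [LcoupOPoly, eval_lsum, List.map_map, LcoupOval]
  congr 1
  refine List.map_congr_left fun b _ => ?_
  simp only [Function.comp_apply, eval_lsum, List.map_map]
  congr 1
  refine List.map_congr_left fun w _ => ?_
  simp only [Function.comp_apply, eval_mulN, eval_phiU, eval_phiV, eval_legT]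

/-- `eval (LcoupDPoly bs) = LcoupDval bs u` (a function of `u` only). [folklore] -/
theorem eval_LcoupDPoly (bs : List LBlk) (u v t : ℝ) :
    eval (LcoupDPoly bs) u v t = LcoupDval bs u := by
  rw [LcoupDPoly, eval_lsum, List.map_map, LcoupDval]
  congr 1
  refine List.map_congr_left fun b _ => ?_
  simp only [Function.comp_apply, eval_lsum, List.map_map]
  congr 1
  refine List.map_congr_left fun w _ => ?_
  simp only [Function.comp_apply, eval_smul, eval_mulN, eval_phiU, eval_legU]
  push_cast; ring

/-- Casting a sum of an integer-valued map. [folklore] -/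
theorem intCast_sum_map {α : Type*} (l : List α) (f : α → ℤ) :
    (((l.map f).sum : ℤ) : ℝ) = (l.map fun a => (f a : ℝ)).sum := by
  induction l with
  | nil => simp
  | cons a l ih => simp [ih]

/-- `c₀ = Σ β² L_l(1)` over the reals equals the kernel integer `c0Of`. [folklore] -/
theorem c0Of_eq (bs : List LBlk) :
    (c0Of bs : ℝ) = (bs.map fun b => (b.vs.map fun w => (w.headD 0 : ℝ) ^ 2 * legendreI b.l 1 1).sum).sum := by
  rw [c0Of, intCast_sum_map]
  congr 1
  refine List.map_congr_left fun b _ => ?_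
  rw [intCast_sum_map]
  congr 1
  refine List.map_congr_left fun w _ => ?_
  push_cast
  rw [← eval_one_one_one, eval_legT]

/-- Values of the multipliers. [folklore] -/
@[simp] theorem eval_qU (c : CapCert) (u v t : ℝ) :
    eval (qU c) u v t = (1 + u) * (c.cbN - c.cbD * u) := by
  simp [qU, Mono.eval]; ring
/-- Values of the multipliers. [folklore] -/
@[simp] theorem eval_qV (c : CapCert) (u v t : ℝ) :
    eval (qV c) u v t = (1 + v) * (c.cbN - c.cbD * v) := by
  simp [qV, Mono.eval]; ring
/-- Values of the multipliers. [folklore] -/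
@[simp] theorem eval_qTb (u v t : ℝ) : eval qTb u v t = (20000 * t - 9799) * (5201 - 10201 * t) := by
  simp [qTb, Mono.eval]; ring
/-- Values of the multipliers. [folklore] -/
@[simp] theorem eval_qTn (u v t : ℝ) : eval qTn u v t = (1 + t) * (101 - 200 * t) := by
  simp [qTn, Mono.eval]; ring
/-- Values of the multipliers. [folklore] -/
@[simp] theorem eval_qUV (c : CapCert) (u v t : ℝ) :
    eval (qUV c) u v t = (c.cbN - c.cbD * u) * (c.cbN - c.cbD * v) := by
  rw [qUV, eval_mulN]; simp [Mono.eval]; ring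

/-- A sum of products of nonnegative multipliers with Gram forms is nonnegative (list form).
[folklore] -/
theorem eval_zipWith_sos_nonneg (u v t : ℝ) : ∀ (ms : List SPoly) (gs : List GramBlk),
    (∀ m ∈ ms, 0 ≤ eval m u v t) → (∀ g ∈ gs, g.lenOK = true) →
    0 ≤ eval (lsum (List.zipWith (fun m g => mulN m (quadL g)) ms gs)) u v t
  | [], _, _, _ => by simp [lsum]
  | _ :: _, [], _, _ => by simp [lsum]
  | m :: ms, g :: gs, hms, hgs => by
    rw [List.zipWith_cons_cons, lsum, eval_append, eval_mulN]
    refine add_nonneg (mul_nonneg (hms m (by simp)) (eval_quadL_nonneg g (hgs g (by simp)) u v t)) ?_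
    exact eval_zipWith_sos_nonneg u v t ms gs (fun m' hm' => hms m' (by simp [hm']))
      (fun g' hg' => hgs g' (by simp [hg']))

/-- A sum of products of nonnegative multipliers with Gram forms is nonnegative. [folklore] -/
theorem eval_sosPoly_nonneg (ms : List SPoly) (gs : List GramBlk) (h : gramsOK ms gs = true)
    (u v t : ℝ) (hms : ∀ m ∈ ms, 0 ≤ eval m u v t) : 0 ≤ eval (sosPoly ms gs) u v t := by
  simp only [gramsOK, Bool.and_eq_true, decide_eq_true_eq, List.all_eq_true] at h
  exact eval_zipWith_sos_nonneg u v t ms gs hms h.2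

end Summit.AtomisticToContinuum.Crystallization.Theorems.Cap.Cert
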